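import Literature.NumberTheory.Sieve.DickmanFunction
import Literature.NumberTheory.LFunctions.MertensSecondLogPower
import Mathlib.NumberTheory.SmoothNumbers
import Mathlib.Algebra.Order.Floor.Semifield
import HarnessLib

/-!
# `Ψ(t, y) = tρ(u)(1 + O(1/log y))` for `y ≤ t ≤ y²` (the initial range of Hildebrand's induction)

Topic `Literature/NumberTheory/Sieve`; a PROVED tool file toward `Literature.NumberTheory.Sieve.HTLocalBehaviour`
(Hildebrand–Tenenbaum 1986, Theorem 3) in the range of small `u`. Hildebrand's inductive proof of de Bruijn's
asymptotic `Ψ(x, y) = xρ(u)(1 + O(·))` [Hildebrand1986, Thm 1, §3] starts from the "initial condition"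
`1 ≤ u ≤ 2`, where ([Hildebrand1986, §3, display before (5)])
`Ψ(y^u, y) = [y^u] - Σ_{y < p ≤ y^u} [y^u/p] = y^u (1 - log u + O(1/log y)) = y^u ρ(u)(1 + O(1/log y))`
by Mertens' theorem and `ρ(u) = 1 - log u` (`1 ≤ u ≤ 2`). We prove exactly this:

* `card_roughNumbersUpTo_eq` — for `N < k²` the `k`-rough `n ≤ N` number `Σ_{k ≤ p ≤ N} [N/p]` (each has
  exactly one prime factor `≥ k`);
* `abs_card_sub_mul_dickmanRho_le_base` — **the estimate**: `|Ψ(t, y) - tρ(log t/log y)| ≤ C t/log y` for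
  `3 ≤ y ≤ t ≤ y²`.

## References

* [Hildebrand1986] A. Hildebrand, J. Number Theory 22 (1986) 289–307, §3 (p. 298).
* [HildebrandTenenbaum1986] A. Hildebrand, G. Tenenbaum, Trans. AMS 296 (1986) 265–290, §1 (1.5).
-/

noncomputable section

open Finset Real Chebyshev

namespace Literature.NumberTheory.Sieve

namespace HildebrandInduction

/-! ### Rough numbers below `k²` -/

/-- For `N < k²`, `#{n ≤ N : n has a prime factor ≥ k} = Σ_{k ≤ p ≤ N} [N/p]` (the sets of multiples of
distinct primes `p, q ≥ k` below `N < k² ≤ pq` are disjoint). [cite: Hildebrand1986, §3 (p. 298)] -/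
theorem card_roughNumbersUpTo_eq {N k : ℕ} (hN : N < k ^ 2) :
    (Nat.roughNumbersUpTo N k).card = ∑ p ∈ (N + 1).primesBelow \ k.primesBelow, N / p := by
  rw [Nat.roughNumbersUpTo_eq_biUnion, Finset.card_biUnion]
  · exact Finset.sum_congr rfl fun p _ => Nat.card_multiples' N p
  · intro p hp q hq hpq
    simp only [Finset.coe_sdiff, Set.mem_sdiff, Finset.mem_coe, Nat.mem_primesBelow, not_and] at hp hq
    have hkp : k ≤ p := by
      by_contra h; push Not at h; exact absurd hp.1.2 (hp.2 h)
    have hkq : k ≤ q := by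
      by_contra h; push Not at h; exact absurd hq.1.2 (hq.2 h)
    rw [Function.onFun, Finset.disjoint_left]
    intro m hmp hmq
    simp only [Finset.mem_filter, Finset.mem_range] at hmp hmq
    have hcop : Nat.Coprime p q := (Nat.coprime_primes hp.1.2 hq.1.2).2 hpq
    have hdvd : p * q ∣ m := Nat.Coprime.mul_dvd_of_dvd_of_dvd hcop hmp.2.2 hmq.2.2
    have hle : p * q ≤ m := Nat.le_of_dvd (Nat.pos_of_ne_zero hmp.2.1) hdvd
    have : k ^ 2 ≤ p * q := by rw [sq]; exact Nat.mul_le_mul hkp hkq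
    omega

/-- `Ψ(N, k) = N - Σ_{k ≤ p ≤ N} [N/p]` for `N < k²`. [cite: Hildebrand1986, §3 (p. 298)] -/
theorem card_smoothNumbersUpTo_eq_sub {N k : ℕ} (hN : N < k ^ 2) :
    ((Nat.smoothNumbersUpTo N k).card : ℝ) = N - ∑ p ∈ (N + 1).primesBelow \ k.primesBelow, ((N / p : ℕ) : ℝ) := by
  have h := Nat.smoothNumbersUpTo_card_add_roughNumbersUpTo_card N k
  rw [card_roughNumbersUpTo_eq hN] at h
  have h' : ((Nat.smoothNumbersUpTo N k).card : ℝ) + ((∑ p ∈ (N + 1).primesBelow \ k.primesBelow, N / p : ℕ) : ℝ) = N := by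
    exact_mod_cast h
  push_cast at h'
  linarith

/-- The index set `{p prime : y < p ≤ N}` as a difference of `primesLE`. [folklore] -/
theorem primesBelow_sdiff_eq (N y : ℕ) :
    (N + 1).primesBelow \ (y + 1).primesBelow = Nat.primesLE N \ Nat.primesLE y := rfl

/-! ### The initial range `y ≤ t ≤ y²` -/

/-- **`Ψ(t, y) = tρ(u)(1 + O(1/log y))` for `y ≤ t ≤ y²`** (`u = log t/log y ∈ [1, 2]`, `ρ(u) = 1 - log u`):
there is an absolute `C` with `|Ψ(t, y) - tρ(log t/log y)| ≤ C t/log y` for all `3 ≤ y ≤ t ≤ y²`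
(`Ψ(t,y) = [t] - Σ_{y<p≤t} [t/p]`, Mertens' `Σ_{p ≤ x} 1/p = log log x + B + O(1/log² x)`, and
`#{y < p ≤ t} ≤ θ(t)/log y ≤ (log 4) t/log y`). [cite: Hildebrand1986, §3 (p. 298, "initial condition" (4))] -/
theorem abs_card_sub_mul_dickmanRho_le_base :
    ∃ C : ℝ, 0 ≤ C ∧ ∀ (y : ℕ) (t : ℝ), 3 ≤ y → (y : ℝ) ≤ t → t ≤ (y : ℝ) ^ 2 →
      |((Nat.smoothNumbersUpTo ⌊t⌋₊ (y + 1)).card : ℝ) - t * dickmanRho (Real.log t / Real.log y)| ≤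
        C * t / Real.log y := by
  obtain ⟨K, hK⟩ := LFunctions.Mertens.abs_sum_primesLE_inv_sub_loglog_le 2
  have hK0 : 0 ≤ K := by
    have h := hK 2 le_rfl
    have hl : 0 < Real.log 2 := Real.log_pos one_lt_two
    have : 0 ≤ K / Real.log 2 ^ 2 := le_trans (abs_nonneg _) h
    by_contra hneg; push Not at hneg
    have : K / Real.log 2 ^ 2 < 0 := div_neg_of_neg_of_pos hneg (by positivity)
    linarith
  refine ⟨2 * K + 4, by positivity, fun y t hy hyt hty => ?_⟩
  have hy3 : (3 : ℝ) ≤ y := by exact_mod_cast hy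
  have hy0 : (0 : ℝ) < y := by linarith
  have ht0 : 0 < t := by linarith
  have ht1 : 1 ≤ t := by linarith
  set L := Real.log y with hL
  have hL1 : 1 ≤ L := by
    rw [hL, Real.le_log_iff_exp_le hy0]
    exact (Real.exp_one_lt_d9.le.trans (by norm_num)).trans hy3
  have hL0 : 0 < L := by linarith
  have hlogt : L ≤ Real.log t := Real.log_le_log hy0 hyt
  have hlogt2 : Real.log t ≤ 2 * L := by
    have := Real.log_le_log ht0 hty
    rwa [Real.log_pow, Nat.cast_ofNat] at this
  set u := Real.log t / L with hu
  have hu1 : 1 ≤ u := by rw [hu, le_div_iff₀ hL0, one_mul]; exact hlogt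
  have hu2 : u ≤ 2 := by rw [hu, div_le_iff₀ hL0]; exact hlogt2
  -- the combinatorial identity
  set N := ⌊t⌋₊ with hN
  have hNt : (N : ℝ) ≤ t := Nat.floor_le ht0.le
  have htN : t < N + 1 := Nat.lt_floor_add_one t
  have hyN : y ≤ N := Nat.le_floor hyt
  have hN2 : N < (y + 1) ^ 2 := by
    have h1 : (N : ℝ) ≤ (y : ℝ) ^ 2 := hNt.trans hty
    have h2 : N ≤ y ^ 2 := by exact_mod_cast h1
    calc N ≤ y ^ 2 := h2
      _ < (y + 1) ^ 2 := by nlinarith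
  have hΨ := card_smoothNumbersUpTo_eq_sub hN2
  rw [primesBelow_sdiff_eq] at hΨ
  set P := Nat.primesLE N \ Nat.primesLE y with hP
  -- the prime reciprocal sum over `y < p ≤ N`
  have hsub : Nat.primesLE y ⊆ Nat.primesLE N := by
    intro p hp
    rw [Nat.mem_primesLE] at hp ⊢
    exact ⟨hp.1.trans hyN, hp.2⟩
  have hrecip : |∑ p ∈ P, (p : ℝ)⁻¹ - Real.log u| ≤ 2 * (K / L ^ 2) := by
    have h1 := hK t (by linarith)
    have h2 := hK y (by linarith)
    rw [Nat.floor_natCast, ← hL] at h2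
    rw [← hN] at h1
    have hsd : ∑ p ∈ P, (p : ℝ)⁻¹ = ∑ p ∈ Nat.primesLE N, (p : ℝ)⁻¹ - ∑ p ∈ Nat.primesLE y, (p : ℝ)⁻¹ := by
      rw [hP, Finset.sum_sdiff_eq_sub hsub]
    have hlogu : Real.log u = Real.log (Real.log t) - Real.log L := by
      rw [hu, Real.log_div (by linarith) hL0.ne']
    rw [hsd, hlogu]
    have hlt : L ^ 2 ≤ Real.log t ^ 2 := by gcongr
    have e1 : K / Real.log t ^ 2 ≤ K / L ^ 2 := div_le_div_of_nonneg_left hK0 (by positivity) hlt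
    rw [abs_le] at h1 h2 ⊢
    constructor <;> nlinarith [h1.1, h1.2, h2.1, h2.2, e1]
  -- the number of primes in `(y, N]`
  have hcount : (P.card : ℝ) * L ≤ Real.log 4 * t := by
    have h1 : (P.card : ℝ) * L ≤ ∑ p ∈ P, Real.log p := by
      rw [← nsmul_eq_mul, ← Finset.sum_const]
      refine Finset.sum_le_sum fun p hp => ?_
      rw [hP, Finset.mem_sdiff, Nat.mem_primesLE, Nat.mem_primesLE, not_and'] at hp
      have hyp : y < p := not_le.1 (hp.2 hp.1.2)
      exact Real.log_le_log hy0 (by exact_mod_cast hyp.le)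
    have h2 : ∑ p ∈ P, Real.log p ≤ θ t := by
      rw [theta_eq_sum_primesLE, ← hN]
      exact Finset.sum_le_sum_of_subset_of_nonneg Finset.sdiff_subset fun p _ _ => Real.log_natCast_nonneg p
    have h3 : θ t ≤ Real.log 4 * t := theta_le_log4_mul_x ht0.le
    linarith
  -- `Σ_{p ∈ P} [t/p]` against `t Σ_{p ∈ P} 1/p`
  have hfloor : ∀ p ∈ P, ((N / p : ℕ) : ℝ) ≤ t / p ∧ t / p - 1 ≤ ((N / p : ℕ) : ℝ) := by
    intro p hp
    have hfl : N / p = ⌊t / p⌋₊ := by rw [hN, Nat.floor_div_natCast]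
    rw [hfl]
    have hp0 : (0 : ℝ) < p := by
      rw [hP, Finset.mem_sdiff, Nat.mem_primesLE] at hp
      exact_mod_cast hp.1.2.pos
    exact ⟨Nat.floor_le (div_nonneg ht0.le hp0.le), by linarith [Nat.lt_floor_add_one (t / p)]⟩
  have hsum_up : ∑ p ∈ P, ((N / p : ℕ) : ℝ) ≤ t * ∑ p ∈ P, (p : ℝ)⁻¹ := by
    rw [Finset.mul_sum]
    exact Finset.sum_le_sum fun p hp => by rw [← div_eq_mul_inv]; exact (hfloor p hp).1
  have hsum_lo : t * ∑ p ∈ P, (p : ℝ)⁻¹ - P.card ≤ ∑ p ∈ P, ((N / p : ℕ) : ℝ) := by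
    rw [Finset.mul_sum]
    have : ∑ p ∈ P, (t * (p : ℝ)⁻¹ - 1) ≤ ∑ p ∈ P, ((N / p : ℕ) : ℝ) :=
      Finset.sum_le_sum fun p hp => by rw [← div_eq_mul_inv]; exact (hfloor p hp).2
    rw [Finset.sum_sub_distrib, Finset.sum_const, nsmul_eq_mul, mul_one] at this
    exact this
  -- `ρ(u) = 1 - log u`
  have hρ : dickmanRho u = 1 - Real.log u := dickmanRho_eq_one_sub_log ⟨hu1, hu2⟩
  rw [hΨ, hρ]
  -- assemble
  have hcard : (P.card : ℝ) ≤ Real.log 4 * t / L := by rw [le_div_iff₀ hL0]; exact hcount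
  have hl4 : Real.log 4 ≤ 2 := by
    have := Real.log_le_sub_one_of_pos (show (0 : ℝ) < 4 by norm_num)
    have h2 : Real.log 4 = 2 * Real.log 2 := by
      rw [show (4 : ℝ) = 2 ^ 2 by norm_num, Real.log_pow]; norm_num
    have := Real.log_le_sub_one_of_pos (show (0 : ℝ) < 2 by norm_num)
    linarith
  have hrec := abs_le.1 hrecip
  have htL : 1 ≤ t / L := by
    rw [le_div_iff₀ hL0, one_mul]
    have := Real.log_le_sub_one_of_pos hy0
    linarith
  have hL2 : t / L ^ 2 ≤ t / L := by
    apply div_le_div_of_nonneg_left ht0.le hL0; nlinarith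
  have hKL : 2 * K * (t / L ^ 2) ≤ 2 * K * (t / L) := mul_le_mul_of_nonneg_left hL2 (by positivity)
  have h5 : (2 * K + 4) * t / L = 2 * K * (t / L) + 4 * (t / L) := by ring
  have hS := hsum_up
  have hS' := hsum_lo
  set S := ∑ p ∈ P, ((N / p : ℕ) : ℝ) with hSdef
  set R := ∑ p ∈ P, (p : ℝ)⁻¹ with hRdef
  have hR1 : t * R ≤ t * Real.log u + 2 * K * (t / L ^ 2) := by
    have := mul_le_mul_of_nonneg_left (show R ≤ Real.log u + 2 * (K / L ^ 2) by linarith [hrec.2]) ht0.le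
    have e2 : t * (Real.log u + 2 * (K / L ^ 2)) = t * Real.log u + 2 * K * (t / L ^ 2) := by ring
    linarith
  have hR2 : t * Real.log u - 2 * K * (t / L ^ 2) ≤ t * R := by
    have := mul_le_mul_of_nonneg_left (show Real.log u - 2 * (K / L ^ 2) ≤ R by linarith [hrec.1]) ht0.le
    have e2 : t * (Real.log u - 2 * (K / L ^ 2)) = t * Real.log u - 2 * K * (t / L ^ 2) := by ring
    linarith
  have e3 : (P.card : ℝ) ≤ 2 * (t / L) := by
    calc (P.card : ℝ) ≤ Real.log 4 * t / L := hcard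
      _ = Real.log 4 * (t / L) := by ring
      _ ≤ 2 * (t / L) := by gcongr
  have hgoal : (N : ℝ) - S - t * (1 - Real.log u) = (N : ℝ) - t - S + t * Real.log u := by ring
  rw [hgoal, h5, abs_le]
  constructor
  · linarith
  · linarith

end HildebrandInduction

end Literature.NumberTheory.Sieve

end
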